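import Summits.SmoothPoincare4.SmoothPoincare4.Theorems.ConvexBisectionAcyclicBisectionExistsPageTwistingTransverseLoop
import Summits.SmoothPoincare4.SmoothPoincare4.Theorems.ConvexBisectionAcyclicBisectionExistsPageTubeDeriv
import Summits.SmoothPoincare4.SmoothPoincare4.Theorems.ConvexBisectionAcyclicBisectionExistsBeltTubeReflect
import Literature.Topology.PlaneTopology.AnnulusLogarithm
import Literature.Topology.PlaneTopology.JordanSweepParity
import HarnessLib

/-!
# The page twisting of the one-twist fibre framing of the core of a page tube, I: the twisting loop
(node T3c-1 `node_belt_isotopic_pushoff` of the sub-goal T3 of stub `stub_steinRealisation` (NF6), line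
`modp-braid-orbits`, crux `ConvexBisection.AcyclicBisectionExists`, item stmt-SmoothPoincare4-10508;
wave 4, worker Y2, lead c5; bookkeeping (4) of stage (3d), reduced by the assembler Y1 to a computation AT
THE CORE of Z4's page tube)

Let `Φ` be the page tube of worker Z4 around a smoothly embedded page curve `K ⊂ page g c` (its CORE and
FIBRE DERIVATIVE clauses taken as hypotheses: `Φ (ψ, 0) = K ψ` and, read in `ℝ⁴`,
`d/dv|₀ Φ (e^{2πiτ}, v) = v₀ · a · i K'(τ) + v₁ · κ · rotField (K (e^{2πiτ}))`, `a, κ > 0`).  For a slide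
direction `b` (`σ_b = slideSign b = ±1`, `uDir b (e^{2πit}) = e^{2πiσ_b t}`) and a sign `s = ±1`, the
re-parametrised core `θ ↦ K (uDir b θ)` carries the fibre framing
`ν θ = d/dε|₀ Φ (uDir b θ, ε reflFibre s θ)`, `reflFibre s θ = (θ₀, s θ₁)`; its page twisting is `s · σ_b`
(sequel `…BeltCoreTwisting.lean`).  This file prepares the computation:

* §1 **the winding number of an "ellipse-like" loop** `t ↦ (σ (A cos 2πt + s B sin 2πt), s D sin 2πt)`,
  `A, D > 0`: it is `σ s` (`wind_ellipseLike`, registered as `helper_wind_ellipseLike`: straight-line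
  homotopy of the coefficients through non-vanishing loops to the signed circle `(σ cos, s sin)`, then
  `wind_circleLoop_zero`, `wind_conj`, `wind_neg`);
* §2 pointwise algebra of the page frame: `⟪iT, n⟫ = 0` for `T` in the complex tangent line of the page, and
  **`⟪rotField, n⟫ = ‖w‖² / ‖dΦ‖² > 0`** near the base (`dw (rotField) = i w`);
* §3 the re-parametrised core (`uDir b (e^{2πit}) = e^{2πiσ_b t}`, velocity `σ_b K'(σ_b t)`) and **the ambient
  framing vector at the core** `cos 2πt · a · iK'(σ_b t) + s sin 2πt · κ · rot` (chain rule through Z4's fibre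
  derivative, `ambient_coreFraming`).

Everything is proved; no named facts.

## References
* J. B. Etnyre, T. Fuller, *Realizing 4-manifolds as achiral Lefschetz fibrations*, IMRN 2006, §2. [EtnyreFuller2006]
* W. Fulton, *Algebraic Topology: A First Course* (1995), §3 (winding numbers). [Fulton1995]
-/

noncomputable section

-- the prescribed namespace `Summit.<P>.<Sub>.…` duplicates `SmoothPoincare4` (P = Sub)
set_option linter.dupNamespace false

open scoped Manifold ContDiff Topology Real ComplexConjugate
open Set Function Metric

namespace Summit.SmoothPoincare4.SmoothPoincare4.Theorems.AcyclicBisectionExists.ModpBraidOrbits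

open Literature.Topology.FourManifolds Literature.Topology.FourManifolds.LefschetzBase
  Literature.Geometry.Symplectic Literature.Topology.PlaneTopology

/-! ### §1 The winding number of an ellipse-like loop -/

/-- The unit circle loop in coordinates: `circleLoop 0 1 t = (cos 2πt, sin 2πt)`. [folklore] -/
theorem circleLoop_zero_one (t : ℝ) :
    circleLoop 0 1 t = (⟨Real.cos (2 * π * t), Real.sin (2 * π * t)⟩ : ℂ) := by
  rw [circleLoop_apply, zero_add, Complex.ofReal_one, one_mul]
  apply Complex.ext
  · rw [Complex.exp_re]
    simp
  · rw [Complex.exp_im]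
    simp

/-- The four signed unit circles `t ↦ (σ cos 2πt, s sin 2πt)`, `σ, s = ±1`, wind `σ s` times. [folklore] -/
theorem wind_signedCircle {σ s : ℝ} (hσ : σ = 1 ∨ σ = -1) (hs : s = 1 ∨ s = -1) :
    ((wind fun t : ℝ => (⟨σ * Real.cos (2 * π * t), s * Real.sin (2 * π * t)⟩ : ℂ)) : ℝ) = σ * s := by
  have hcirc : IsNonvanishingLoop (circleLoop 0 1) := isNonvanishingLoop_circleLoop (by simp)
  have hconj : IsNonvanishingLoop fun t => conj (circleLoop 0 1 t) :=
    ⟨Complex.continuous_conj.comp_continuousOn hcirc.continuousOn,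
      fun t ht h0 => hcirc.ne_zero t ht ((map_eq_zero _).1 h0), by rw [hcirc.eq_endpoints]⟩
  have w1 : wind (circleLoop 0 1) = 1 := wind_circleLoop_zero one_pos
  rcases hσ with rfl | rfl <;> rcases hs with rfl | rfl
  · have e : (fun t : ℝ => (⟨1 * Real.cos (2 * π * t), 1 * Real.sin (2 * π * t)⟩ : ℂ)) = circleLoop 0 1 := by
      funext t; rw [circleLoop_zero_one]; apply Complex.ext <;> simp
    rw [e, w1]; norm_num
  · have e : (fun t : ℝ => (⟨1 * Real.cos (2 * π * t), -1 * Real.sin (2 * π * t)⟩ : ℂ)) =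
        fun t => conj (circleLoop 0 1 t) := by
      funext t; rw [circleLoop_zero_one]; apply Complex.ext <;> simp
    rw [e, wind_conj hcirc, w1]; norm_num
  · have e : (fun t : ℝ => (⟨-1 * Real.cos (2 * π * t), 1 * Real.sin (2 * π * t)⟩ : ℂ)) =
        fun t => -conj (circleLoop 0 1 t) := by
      funext t; rw [circleLoop_zero_one]; apply Complex.ext <;> simp
    rw [e, wind_neg hconj, wind_conj hcirc, w1]; norm_num
  · have e : (fun t : ℝ => (⟨-1 * Real.cos (2 * π * t), -1 * Real.sin (2 * π * t)⟩ : ℂ)) =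
        fun t => -circleLoop 0 1 t := by
      funext t; rw [circleLoop_zero_one]; apply Complex.ext <;> simp
    rw [e, wind_neg hcirc, w1]; norm_num

/-- **The winding number of an ellipse-like loop.**  For `A, D > 0` and `B` continuous on `[0, 1]` with
equal end values and signs `σ, s = ±1`, the loop `t ↦ (σ (A cos 2πt + s B sin 2πt), s D sin 2πt)` winds
`σ s` times about `0`: it is homotopic through non-vanishing loops (straight-line homotopy of the
coefficients to `A = D = 1`, `B = 0`; a zero would force `sin = 0` and then `cos = 0`) to the signed circle
`(σ cos, s sin)`. [cite: Fulton1995, §3] -/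
theorem wind_ellipseLike {A B D : ℝ → ℝ} (hA : ContinuousOn A (Icc 0 1)) (hB : ContinuousOn B (Icc 0 1))
    (hD : ContinuousOn D (Icc 0 1)) (hA0 : ∀ t ∈ Icc (0 : ℝ) 1, 0 < A t) (hD0 : ∀ t ∈ Icc (0 : ℝ) 1, 0 < D t)
    (hA1 : A 0 = A 1) (hB1 : B 0 = B 1) (hD1 : D 0 = D 1) {σ s : ℝ} (hσ : σ = 1 ∨ σ = -1) (hs : s = 1 ∨ s = -1) :
    ((wind fun t : ℝ => (⟨σ * (A t * Real.cos (2 * π * t) + s * B t * Real.sin (2 * π * t)),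
      s * D t * Real.sin (2 * π * t)⟩ : ℂ)) : ℝ) = σ * s := by
  have hσ0 : σ ≠ 0 := by rcases hσ with rfl | rfl <;> norm_num
  have hs0 : s ≠ 0 := by rcases hs with rfl | rfl <;> norm_num
  -- the homotopy of coefficients
  set H : ℝ → ℝ → ℂ := fun l t => ⟨σ * (((1 - l) * A t + l) * Real.cos (2 * π * t) +
    s * ((1 - l) * B t) * Real.sin (2 * π * t)), s * ((1 - l) * D t + l) * Real.sin (2 * π * t)⟩ with hH
  have hcont : ContinuousOn (uncurry H) (Icc 0 1 ×ˢ Icc 0 1) := by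
    have hA' : ContinuousOn (fun p : ℝ × ℝ => A p.2) (Icc 0 1 ×ˢ Icc 0 1) :=
      hA.comp continuousOn_snd fun p hp => hp.2
    have hB' : ContinuousOn (fun p : ℝ × ℝ => B p.2) (Icc 0 1 ×ˢ Icc 0 1) :=
      hB.comp continuousOn_snd fun p hp => hp.2
    have hD' : ContinuousOn (fun p : ℝ × ℝ => D p.2) (Icc 0 1 ×ˢ Icc 0 1) :=
      hD.comp continuousOn_snd fun p hp => hp.2
    have hre : ContinuousOn (fun p : ℝ × ℝ => σ * (((1 - p.1) * A p.2 + p.1) * Real.cos (2 * π * p.2) +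
        s * ((1 - p.1) * B p.2) * Real.sin (2 * π * p.2))) (Icc 0 1 ×ˢ Icc 0 1) := by
      apply ContinuousOn.mul continuousOn_const
      apply ContinuousOn.add
      · exact ((((continuousOn_const.sub continuousOn_fst).mul hA').add continuousOn_fst).mul
          (by fun_prop))
      · exact ((continuousOn_const.mul ((continuousOn_const.sub continuousOn_fst).mul hB')).mul (by fun_prop))
    have him : ContinuousOn (fun p : ℝ × ℝ => s * ((1 - p.1) * D p.2 + p.1) * Real.sin (2 * π * p.2))
        (Icc 0 1 ×ˢ Icc 0 1) :=
      (continuousOn_const.mul (((continuousOn_const.sub continuousOn_fst).mul hD').add continuousOn_fst)).mul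
        (by fun_prop)
    have hform : uncurry H = fun p : ℝ × ℝ =>
        ((σ * (((1 - p.1) * A p.2 + p.1) * Real.cos (2 * π * p.2) +
          s * ((1 - p.1) * B p.2) * Real.sin (2 * π * p.2)) : ℝ) : ℂ) +
        ((s * ((1 - p.1) * D p.2 + p.1) * Real.sin (2 * π * p.2) : ℝ) : ℂ) * Complex.I := by
      funext p
      rw [← Complex.mk_eq_add_mul_I]
      rfl
    rw [hform]
    exact (Complex.continuous_ofReal.comp_continuousOn hre).add
      ((Complex.continuous_ofReal.comp_continuousOn him).mul
        (continuousOn_const : ContinuousOn (fun _ : ℝ × ℝ => Complex.I) _))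
  have hloop : ∀ l ∈ Icc (0 : ℝ) 1, H l 0 = H l 1 := by
    intro l _
    simp only [hH, mul_zero, mul_one, Real.cos_zero, Real.sin_zero, Real.cos_two_pi, Real.sin_two_pi, hA1, hB1, hD1]
  have hne : ∀ l ∈ Icc (0 : ℝ) 1, ∀ t ∈ Icc (0 : ℝ) 1, H l t ≠ 0 := by
    intro l hl t ht h0
    have hAl : 0 < (1 - l) * A t + l := by
      rcases eq_or_lt_of_le hl.1 with h | h
      · rw [← h]; simpa using hA0 t ht
      · nlinarith [mul_nonneg (sub_nonneg.2 hl.2) (hA0 t ht).le]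
    have hDl : 0 < (1 - l) * D t + l := by
      rcases eq_or_lt_of_le hl.1 with h | h
      · rw [← h]; simpa using hD0 t ht
      · nlinarith [mul_nonneg (sub_nonneg.2 hl.2) (hD0 t ht).le]
    have him : Real.sin (2 * π * t) = 0 := by
      have h := congrArg Complex.im h0
      simp only [hH, Complex.zero_im] at h
      simpa [hs0, hDl.ne'] using h
    have hcos : Real.cos (2 * π * t) = 0 := by
      have h := congrArg Complex.re h0
      simp only [hH, Complex.zero_re, him, mul_zero, add_zero] at h
      simpa [hσ0, hAl.ne'] using h
    have := Real.cos_sq_add_sin_sq (2 * π * t)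
    rw [hcos, him] at this
    norm_num at this
  have hw := wind_eq_of_homotopy hcont hloop hne
  have e0 : H 0 = fun t : ℝ => (⟨σ * (A t * Real.cos (2 * π * t) + s * B t * Real.sin (2 * π * t)),
      s * D t * Real.sin (2 * π * t)⟩ : ℂ) := by
    funext t; simp only [hH]; apply Complex.ext <;> simp
  have e1 : H 1 = fun t : ℝ => (⟨σ * Real.cos (2 * π * t), s * Real.sin (2 * π * t)⟩ : ℂ) := by
    funext t; simp only [hH]; apply Complex.ext <;> simp
  rw [← e0, hw, e1]
  exact wind_signedCircle hσ hs

/-! ### §2 Pointwise algebra of the page frame -/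

variable {g : ℕ}

/-- **`⟪iT, n(q)⟫ = 0` for `T` in the complex tangent line of the page through `q`** (`dΦ_q(T) = 0`): the
horizontal normal is `ℂ`-orthogonal to the page. [folklore] -/
theorem inner_cplxJ_horizNormal_eq_zero {q T : EuclideanSpace ℝ (Fin 4)}
    (hT : dPhiX g q * cx T + dPhiY q * cy T = 0) : inner ℝ (cplxJ T) (horizNormal g q) = 0 := by
  rw [inner_horizNormal, cx_cplxJ, cy_cplxJ]
  have e : dPhiX g q * (Complex.I * cx T) + dPhiY q * (Complex.I * cy T) =
      Complex.I * (dPhiX g q * cx T + dPhiY q * cy T) := by ring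
  rw [e, hT, mul_zero, mul_zero, Complex.zero_im, zero_div]

/-- **`⟪rotField, n⟫ = ‖w‖² / ‖dΦ‖²` on `{rho ≤ 3/10}`**: there `dw (rotField) = i w`
(`fderiv_w_rotField_of_le`) and `⟪V, n⟫ = Im (w̄ · dw(V)) / ‖dΦ‖²` (`inner_horizNormal`); in particular the
rotation field is positively transverse to the pages. [folklore] -/
theorem inner_rotField_horizNormal {q : EuclideanSpace ℝ (Fin 4)} (hρ : rho g q ≤ 3 / 10) :
    inner ℝ (rotField g q) (horizNormal g q) = ‖w g q‖ ^ 2 / (‖dPhiX g q‖ ^ 2 + ‖dPhiY q‖ ^ 2) := by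
  rw [inner_horizNormal, ← fderiv_w_apply, fderiv_w_rotField_of_le hρ]
  congr 1
  have e : conj (w g q) * (Complex.I * w g q) = Complex.I * (w g q * conj (w g q)) := by ring
  rw [e, Complex.mul_conj, Complex.I_mul_im, Complex.ofReal_re, Complex.normSq_eq_norm_sq]

/-! ### §3 The twisting loop of the fibre framing of the re-parametrised core -/

/-- `uDir b (e^{2πit}) = e^{2πi σ_b t}`. [folklore] -/
theorem uDir_circlePt (b : Bool) (t : ℝ) : uDir b (circlePt t) = circlePt (slideSign b * t) := by
  apply Subtype.ext
  rw [coe_uDir]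
  ext i
  fin_cases i
  · cases b
    · simp [slideSign]
    · simp only [slideSign, if_true, circlePt_apply_zero, neg_one_mul]
      simp [Real.cos_neg]
  · cases b
    · simp [slideSign]
    · simp only [slideSign, if_true, circlePt_apply_one, neg_one_mul]
      simp [Real.sin_neg]

/-- `slideSign b = ±1`. [folklore] -/
theorem slideSign_eq_or (b : Bool) : slideSign b = 1 ∨ slideSign b = -1 := by
  cases b
  · exact Or.inl rfl
  · exact Or.inr rfl

variable {K : sphere (0 : EuclideanSpace ℝ (Fin 2)) 1 → Base g}

/-- The ambient parametrisation of the re-parametrised core: `ambCurve (K ∘ uDir b) t = ambCurve K (σ_b t)`.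
[folklore] -/
theorem ambCurve_comp_uDir (b : Bool) :
    ambCurve g (fun θ => K (uDir b θ)) = fun t => ambCurve g K (slideSign b * t) := by
  funext t
  simp only [ambCurve, uDir_circlePt]

/-- Its velocity: `(ambCurve (K ∘ uDir b))' t = σ_b (ambCurve K)' (σ_b t)`. [folklore] -/
theorem deriv_ambCurve_comp_uDir (b : Bool) (t : ℝ) :
    deriv (ambCurve g (fun θ => K (uDir b θ))) t = slideSign b • deriv (ambCurve g K) (slideSign b * t) := by
  rw [ambCurve_comp_uDir]
  exact deriv_comp_mul_left (slideSign b) (ambCurve g K) t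

/-- The ambient velocity of a smoothly embedded loop never vanishes. [folklore] -/
theorem deriv_ambCurve_ne_zero (hK : Manifold.IsSmoothEmbedding (𝓡 1) (𝓡∂ 4) ∞ K) (t : ℝ) :
    deriv (ambCurve g K) t ≠ 0 := by
  rw [deriv_ambCurve (hK.contMDiff.mdifferentiableAt (by simp))]
  intro h0
  exact knotVelocity_ne_zero hK t (injective_ambient _ (h0.trans (map_zero _).symm))

/-- Period `1` at the end values `σ_b · 0`, `σ_b · 1`: the point. [folklore] -/
theorem ambCurve_slideSign (b : Bool) : ambCurve g K (slideSign b * 1) = ambCurve g K (slideSign b * 0) := by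
  rw [mul_one, mul_zero]
  cases b
  · have h := ambCurve_add_one (g := g) (L := K) 0
    rw [zero_add] at h
    exact h
  · have h := ambCurve_add_one (g := g) (L := K) (-1)
    rw [neg_add_cancel] at h
    exact h.symm

/-- Period `1` at the end values `σ_b · 0`, `σ_b · 1`: the velocity. [folklore] -/
theorem deriv_ambCurve_slideSign (b : Bool) :
    deriv (ambCurve g K) (slideSign b * 1) = deriv (ambCurve g K) (slideSign b * 0) := by
  rw [mul_one, mul_zero]
  cases b
  · have h := deriv_ambCurve_add_one (g := g) (L := K) 0
    rw [zero_add] at h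
    exact h
  · have h := deriv_ambCurve_add_one (g := g) (L := K) (-1)
    rw [neg_add_cancel] at h
    exact h.symm

/-- **The ambient fibre-framing vector at the core, from Z4's fibre derivative.**  If `Φ (ψ, 0) = K ψ` and
`d/dv|₀ Φ (e^{2πiτ}, v) = v₀ · a · iK'(τ) + v₁ · κ · rot (K (e^{2πiτ}))` (read in `ℝ⁴`), then the framing
vector `d/dε|₀ Φ (uDir b θ, ε reflFibre s θ)` at `θ = e^{2πit}`, read in `ℝ⁴`, is
`cos 2πt · a · iK'(σ_b t) + s sin 2πt · κ · rot (K (e^{2πiσ_b t}))`. [folklore] -/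
theorem ambient_coreFraming (Φ : CircleTube (bBase g).carrier) (hcore : ∀ ψ, (bBase g).incl (Φ.core ψ) = K ψ)
    {κ a : ℝ} (hder : ∀ t : ℝ, HasFDerivAt (fun v : EuclideanSpace ℝ (Fin 2) =>
        ((bBase g).incl (Φ.toHomeo (circlePt t, v))).1)
      ((EuclideanSpace.proj (𝕜 := ℝ) (0 : Fin 2)).smulRight (a • cplxJ (deriv (ambCurve g K) t)) +
        (EuclideanSpace.proj (𝕜 := ℝ) (1 : Fin 2)).smulRight (κ • rotField g (K (circlePt t)).1)) 0)
    (b : Bool) (s t : ℝ) :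
    ambient g (K (uDir b (circlePt t)))
        (mfderiv 𝓘(ℝ, ℝ) (𝓡∂ 4) (fun ε : ℝ => (bBase g).incl (Φ.toHomeo (uDir b (circlePt t),
          ε • reflFibre s ((circlePt t : sphere (0 : EuclideanSpace ℝ (Fin 2)) 1) : EuclideanSpace ℝ (Fin 2))))) 0 (1 : ℝ)) =
      Real.cos (2 * π * t) • (a • cplxJ (deriv (ambCurve g K) (slideSign b * t))) +
        (s * Real.sin (2 * π * t)) • (κ • rotField g (ambCurve g K (slideSign b * t))) := by
  have hψ : uDir b (circlePt t) = circlePt (slideSign b * t) := uDir_circlePt b t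
  rw [hψ]
  -- the fibre arc `γ`, its value and smoothness at `0`
  set ζ : EuclideanSpace ℝ (Fin 2) :=
    reflFibre s ((circlePt t : sphere (0 : EuclideanSpace ℝ (Fin 2)) 1) : EuclideanSpace ℝ (Fin 2)) with hζ
  set γ : ℝ → Base g := fun ε => (bBase g).incl (Φ.toHomeo (circlePt (slideSign b * t), ε • ζ)) with hγ
  have hγ0 : γ 0 = K (circlePt (slideSign b * t)) := by
    show (bBase g).incl (Φ.toHomeo (circlePt (slideSign b * t), (0 : ℝ) • ζ)) = _
    rw [zero_smul, ← hcore, CircleTube.core_apply]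
  have hγs : ContMDiffAt 𝓘(ℝ, ℝ) (𝓡∂ 4) ∞ γ 0 := by
    have h1 : ContMDiff 𝓘(ℝ, ℝ) ((𝓡 1).prod 𝓘(ℝ, EuclideanSpace ℝ (Fin 2))) ∞ fun ε : ℝ =>
        ((circlePt (slideSign b * t), ε • ζ) : (sphere (0 : EuclideanSpace ℝ (Fin 2)) 1) × EuclideanSpace ℝ (Fin 2)) :=
      contMDiff_const.prodMk (contMDiff_id.smul contMDiff_const)
    have h0 : ((circlePt (slideSign b * t), (0 : ℝ) • ζ) :
        (sphere (0 : EuclideanSpace ℝ (Fin 2)) 1) × EuclideanSpace ℝ (Fin 2)) ∈ Φ.toHomeo.source := by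
      rw [zero_smul]; exact Φ.mem_source_zero _
    exact ((bBase g).isSmoothEmbedding.contMDiff _).comp 0 ((Φ.contMDiffAt_toHomeo h0).comp 0 (h1 0))
  have hγd := hγs.mdifferentiableAt (by simp)
  -- chain rule with the inclusion `Base g ↪ ℝ⁴`
  have h2 : MDifferentiableAt (𝓡∂ 4) (𝓡 4) (RegularSublevel.incl (isRegularLevel_rho g)) (γ 0) :=
    (RegularSublevel.contMDiff_incl _).mdifferentiableAt (by simp)
  have hc := mfderiv_comp (0 : ℝ) h2 hγd
  have key : ∀ (x : Base g) (_ : x = γ 0) (v : EuclideanSpace ℝ (Fin 4)),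
      ambient g x v = mfderiv (𝓡∂ 4) (𝓡 4) (RegularSublevel.incl (isRegularLevel_rho g)) (γ 0) v := by
    intro x e v; subst e; rfl
  rw [key _ hγ0.symm]
  -- the composite is Z4's fibre map along the line `ε ↦ ε ζ`
  have hline : HasDerivAt (fun ε : ℝ => ε • ζ) ζ 0 := by simpa using (hasDerivAt_id (0 : ℝ)).smul_const ζ
  have hcomp := (hder (slideSign b * t)).comp_hasDerivAt_of_eq (0 : ℝ) hline (by rw [zero_smul])
  have hd : deriv (RegularSublevel.incl (isRegularLevel_rho g) ∘ γ) 0 =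
      ζ 0 • (a • cplxJ (deriv (ambCurve g K) (slideSign b * t))) + ζ 1 • (κ • rotField g (K (circlePt (slideSign b * t))).1) := by
    rw [show RegularSublevel.incl (isRegularLevel_rho g) ∘ γ = (fun v : EuclideanSpace ℝ (Fin 2) =>
      ((bBase g).incl (Φ.toHomeo (circlePt (slideSign b * t), v))).1) ∘ fun ε : ℝ => ε • ζ from rfl]
    exact hcomp.deriv
  have e2 : deriv (RegularSublevel.incl (isRegularLevel_rho g) ∘ γ) 0 =
      mfderiv (𝓡∂ 4) (𝓡 4) (RegularSublevel.incl (isRegularLevel_rho g)) (γ 0) (mfderiv 𝓘(ℝ, ℝ) (𝓡∂ 4) γ 0 (1 : ℝ)) := by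
    rw [← fderiv_apply_one_eq_deriv, ← mfderiv_eq_fderiv, hc]
    rfl
  rw [← e2, hd]
  congr 1
  · simp [hζ, reflFibre]
  · simp [hζ, reflFibre]
    rfl

/-! ### §4 Registered helper of this file -/

/-- **Registered helper `helper_wind_ellipseLike` (node T3c-1 of NF6 `stub_steinRealisation`, bookkeeping (4) of
stage (3d), wave 4, lead c5): the winding number of the ellipse-like loop
`t ↦ (σ (A cos 2πt + s B sin 2πt), s D sin 2πt)` (`A, D > 0`, `B` continuous on `[0, 1]` with equal end
values, `σ, s = ±1`) is `σ s`.** [cite: Fulton1995, §3] -/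
theorem helper_wind_ellipseLike :
    ∀ (A B D : ℝ → ℝ), ContinuousOn A (Set.Icc 0 1) → ContinuousOn B (Set.Icc 0 1) → ContinuousOn D (Set.Icc 0 1) → (∀ t ∈ Set.Icc (0 : ℝ) 1, 0 < A t) → (∀ t ∈ Set.Icc (0 : ℝ) 1, 0 < D t) → A 0 = A 1 → B 0 = B 1 → D 0 = D 1 → ∀ (σ s : ℝ), (σ = 1 ∨ σ = -1) → (s = 1 ∨ s = -1) → ((Literature.Topology.PlaneTopology.wind fun t : ℝ => (⟨σ * (A t * Real.cos (2 * Real.pi * t) + s * B t * Real.sin (2 * Real.pi * t)), s * D t * Real.sin (2 * Real.pi * t)⟩ : ℂ)) : ℝ) = σ * s :=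
  fun _ _ _ hA hB hD hA0 hD0 hA1 hB1 hD1 _ _ hσ hs => wind_ellipseLike hA hB hD hA0 hD0 hA1 hB1 hD1 hσ hs

end Summit.SmoothPoincare4.SmoothPoincare4.Theorems.AcyclicBisectionExists.ModpBraidOrbits

end
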